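import Summits.RiemannHypothesis.RiemannHypothesis.Theorems.SemilocalSoninIneqOn
import Literature.NumberTheory.ConnesConsani2021.SemilocalTwist
import HarnessLib

/-!
# The semilocal operator obligation in ARCHIMEDEAN form (twisted-Gram reduction)

Cell `rh-explicit`, seat cc-s2-1 (HOME `run/shared/lean/pub/rh-explicit/cc-s2-1/S2-STATEMENT.md` §8,
`S2-CERT-SPEC.md`).  The open obligation `SemilocalSoninIneqOn p a` (sibling file, cc-s2-4) quantifies over
orthonormal families of the SEMILOCAL Sonin space `𝔖_S(1,1) = θ_p S(1,1)`.  Since the printed twist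
`θ_p = 1 − p^{-1/2}ϑ(p)` commutes with the scaling action (tree:
`Literature.NumberTheory.ConnesConsani2021.semilocal_weakTrace_iff`, `soninTraceForm_primeTwist`), the
obligation is EQUIVALENT to a statement about CC's ARCHIMEDEAN Sonin space `S(1,1)` in which the prime enters
only through the 3-point twist `T_p k = k ∗ m_p` of the kernel (`twistKernel`) and the twisted orthonormality
`(θ_p ζ_i)` orthonormal.  This file records that equivalence for the summit-side `Prop` verbatim (no new
statement, no inequality asserted); it is the form in which the cell's finite Sonin sections (float DATA:
`S2-CERT-SPEC.md` §3/§5) and any future certificate address the obligation.  Helper of the WeilPos item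
(anchor `--supports`), like its sibling.
-/

set_option linter.dupNamespace false  -- the mandated namespace repeats `RiemannHypothesis`

noncomputable section

open MeasureTheory Complex Set
open scoped Real

namespace Summit.RiemannHypothesis.RiemannHypothesis

open Literature.NumberTheory.LFunctions Literature.NumberTheory.ConnesConsani2021

/-- The kernel `k = g ⋆ g̃` of a Weil test function is integrable (smooth, compactly supported). [folklore] -/
theorem integrable_weilConv_weilReflect {g : ℝ → ℂ} (hg : IsWeilTest g) :
    Integrable (weilConv g (weilReflect g)) := by
  have hk : IsWeilTest (weilConv g (weilReflect g)) := hg.weilConv hg.weilReflect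
  exact hk.1.continuous.integrable_of_hasCompactSupport hk.2

/-- **`SemilocalSoninIneqOn p a` in archimedean form.**  The obligation is equivalent to: for every Weil test
`g` on `[−a, a]` with CC's two conditions, `k = g ⋆ g̃`, and every finite family `ζ₁, …, ζₙ` of CC's archimedean
Sonin space `S(1,1)` whose twists `θ_p ζ_i` are orthonormal (equivalently `⟨ζ_i | ϑ(m_p) ζ_j⟩ = δ_ij`,
`Literature…inner_primeTwist_primeTwist`),
`Σ_i Re⟨ζ_i | ϑ(T_p k) ζ_i⟩ ≤ Re(W_∞(k) − W_p(k))` with the twisted kernel `T_p k = twistKernel p k`.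
One application of `semilocal_weakTrace_iff` per test function. [folklore] -/
theorem semilocalSoninIneqOn_iff_twisted (p : ℕ) [Fact p.Prime] (a : ℝ) :
    SemilocalSoninIneqOn p a ↔
      ∀ g : ℝ → ℂ, IsWeilTest g → tsupport g ⊆ Icc (-a) a →
        mulFourier g (I / 2) = 0 → mulFourier g 0 = 0 →
        ∀ (n : ℕ) (ζ : Fin n → Lp ℂ 2 (volume : Measure ℝ)),
          Orthonormal ℂ (fun i => primeTwist p (ζ i)) → (∀ i, ζ i ∈ soninSpace 1 1) →
            ∑ i, (soninTraceForm (twistKernel p (weilConv g (weilReflect g))) (ζ i : ℝ → ℂ)).re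
              ≤ (archW (weilConv g (weilReflect g))
                  - weilSemilocalPrimeTerm {p} (weilConv g (weilReflect g))).re := by
  unfold SemilocalSoninIneqOn
  refine forall_congr' fun g => forall_congr' fun hg => forall_congr' fun _ => forall_congr' fun _ =>
    forall_congr' fun _ => ?_
  exact semilocal_weakTrace_iff p (integrable_weilConv_weilReflect hg) 1 1 _

/-- **One-vector refutation criterion for the obligation, archimedean form** (landing point of a finite
certificate; cell `rh-explicit`, `HOME/cc-s2-1/S2-CERT-SPEC.md` §2 and §5.3, where a float candidate
`(g, ζ)` with ratio ≈ 8 at `p = 2`, `a = (log 3)/2` is archived — DATA, not certified).  If some Weil test `g`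
on `[−a, a]` with CC's two conditions and some `ζ ≠ 0` in CC's archimedean Sonin space `S(1,1)` satisfy
`Re(W_∞(k) − W_p(k)) · ‖θ_p ζ‖² < Re⟨ζ | ϑ(T_p k) ζ⟩`, `k = g ⋆ g̃`, then `SemilocalSoninIneqOn p a` fails
(the one-element family `θ_pζ/‖θ_pζ‖` violates it; tree
`Literature.NumberTheory.ConnesConsani2021.not_semilocal_weakTrace_of_twisted_vector`).  Nothing here asserts
that such `(g, ζ)` exist. [folklore] -/
theorem not_semilocalSoninIneqOn_of_twisted_vector (p : ℕ) [Fact p.Prime] {a : ℝ} {g : ℝ → ℂ}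
    (hg : IsWeilTest g) (hsupp : tsupport g ⊆ Icc (-a) a)
    (h1 : mulFourier g (I / 2) = 0) (h0 : mulFourier g 0 = 0)
    {ζ : Lp ℂ 2 (volume : Measure ℝ)} (hζ : ζ ∈ soninSpace 1 1) (hζ0 : ζ ≠ 0)
    (hgt : (archW (weilConv g (weilReflect g))
              - weilSemilocalPrimeTerm {p} (weilConv g (weilReflect g))).re * ‖primeTwist p ζ‖ ^ 2 <
            (soninTraceForm (twistKernel p (weilConv g (weilReflect g))) (ζ : ℝ → ℂ)).re) :
    ¬ SemilocalSoninIneqOn p a := fun h =>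
  not_semilocal_weakTrace_of_twisted_vector p (integrable_weilConv_weilReflect hg) hζ hζ0 hgt
    (h g hg hsupp h1 h0)

end Summit.RiemannHypothesis.RiemannHypothesis
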